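import Summits.QuantumFields.BalabanUV.Beta.GAN24.CapacitanceScalarRateBox

/-!
# `BalabanUV.Beta.GAN24.CapacitanceScalarRateSum` — binder row G-an2-4 / (CONV-C), road P1-fibre, leaf **P1-Y11s** of
# `GAN24/Formal/LEAVES.md` v2.1 — PART 4 of 4: tails (R3) and the TWO-SCALE RATES (R4) of the capacitance scalars

NOT IN PRINT; OUR PROOF ATTEMPT.  HONEST FRAMING (cell contract, verbatim): «discharging `BetaPertH` makes Bałaban's UV stability
UNCONDITIONAL — a real constructive-QFT result; it is NOT the continuum limit and NOT the Clay problem.»  HONEST DEPENDENCY (verbatim):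
«continuum YM on T⁴ ⇐ BetaPertH ∧ nine spine estimates (0/9 proved); BetaPertH ⇐ (D1) ∧ (D4) ∧ CAP+tail; G-an2-4 gates asym, D1 and
NE2/3/4.»  [folklore] real analysis (geometric sums, Jordan, `sin` Taylor bounds, finite alias sums); 0 cite, 0 wall binder, no
`def … : Prop`; it discharges NOTHING of (CONV-C)'s K-slot `GAN24.CombesThomas.ConvCK 3 Lc` by itself — it is the Part-B (rate `θ = Lc⁻²`)
bookkeeping for the two SCALAR alias sums `a_κ(p)`, `σ(p)` of the capacitance matrix `Cap = [[diag(a) − (σ/2)δδ♭ᵀ, σδ],[σδ♭ᵀ, 0]]`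
(leaf-02-g4's structure theorem, `GAN24/CapacitanceClosedForm`), consumed by gan24-p1's row P1-L11 `FibreRate` together with rows Y08s/E4 of
`GAN24/Formal/LEAVES.md` v2.1.  NOT `BetaPertH`, NOT continuum, NOT Clay.  Value = kernel bookkeeping leaf toward the K-slot route P1 of binder
row G-an2-4, NOT summit progress.

## The leaf (P1-Y11s = self-row «L11b*», SKELETON-P1 node N17 `blockwise_rate` restricted to the capacitance scalars) in four parts
1. `GAN24/CapacitanceScalarRate` — the normalised one-coordinate alias weight `aw N x = ‖Σ_{t<N} e^{ixt}‖²/N²`, its continuum reference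
   `awInf q = sinc²(q/2)`, the scaled symbol `symN N q = Σ_i N²·4 sin²(q_i/(2N))`, their RELATIVE second-order comparisons on the scaled
   Brillouin zone (R1), and the product engine `mul_rel` / `prod_rel`;
2. `GAN24/CapacitanceScalarRateTerm` — the summands `fA`, `fS` of `ã_κ = a_κ/N^{D+4}`, `σ̃ = σ/N^{D+4}` versus their continuum references
   (`fA_rel`, `fS_rel`: relative rate `(π²/16)(|q|²/N²)·Kc D`), and the ALIAS WINDOWS (`zrep`, integer alias box `boxZ`, nesting in `N`);
3. `GAN24/CapacitanceScalarRateBox` — `aT N p κ = ã_κ^{(N)}(p)`, `sT N p = σ̃^{(N)}(p)` as sums over `(ℤ/N)^D` in leaf P1-L06's `kfine`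
   currency, their alias-box form, and the `N`-uniform continuum alias-sum bounds (R2) `Σ_box Π_i sinc² ≤ 3^D`;
4. `GAN24/CapacitanceScalarRateSum` — (R3) tails and (R4) the TWO-SCALE RATES `aT_rate : |ã_κ^{(N')}(p) − ã_κ^{(N)}(p)| ≤ rateA D/N²`,
   `sT_rate : |σ̃^{(N')} − σ̃^{(N)}| ≤ rateS D·(1 + |p|⁻²)/N²` for all `1 ≤ N ≤ N'`, `p ∈ [−π, π]^D ∖ {0}`.

## What is proved in this part (every `D`, all levels `1 ≤ N ≤ N'`, `p ∈ [−π, π]^D ∖ {0}`)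
* box terms `abs_fA_sub_fA_le` (`|fA N' − fA N| ≤ (π²/32)·Kc D·pwInf/N²` — the `m = 0` pole `1/(2|p|²)` is CANCELLED by the relative
  rate `|q|²/N²`), `abs_fS_sub_fS_le`; tail terms (R3) `fA_tail_le` (`≤ Kc D·pwInf/(2π²N²)` where `|q|² ≥ π²N²`), `fS_tail_le`
  (`≤ Kc D·pwInf/(π⁴N²)`); `sum_boxZ_pwInf_div_le` (`Σ_box pwInf/|q|² ≤ 1/|p|² + 3^D/π²`);
* **`aT_rate`**: `|aT N' p κ − aT N p κ| ≤ rateA D / N²`, `rateA D = Kc D·3^D·(π²/32 + 1/(2π²))` — uniform in `p`;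
* **`sT_rate`**: `|sT N' p − sT N p| ≤ rateS D·(1 + 1/|p|²)/N²`, `rateS D = Kc D·(π²/16 + 3^D(1/16 + 1/π⁴))`.
With `N = Lc^{j+1}`, `N' = Lc^{j+2}` these are the geometric rates `θ^j`, `θ = Lc⁻²`, of SKELETON-P1 B3/B4 for the capacitance
scalars; with Y08f (closed form) / Y08s (two-sided bounds) / E4 (inverse-rate engine) they give the capacitance half of p1's L11.

Unit `b2b-balaban-gan24-formalise-leaf-07` (G-an2-4 formalisation swarm, leaf prover 07, gen 5), 2026-08-19.
-/

noncomputable section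

open Complex Finset
open scoped BigOperators Real

namespace Summit.QuantumFields.BalabanUV.Beta.GAN24.CapacitanceScalarRateSum

open AliasWeights AliasWeightsSum SymbolTaylor CapacitanceScalarRate CapacitanceScalarRateTerm CapacitanceScalarRateBox
open Literature.MathematicalPhysics.QuantumFieldTheory.King1986 (momSq momSq_nonneg)

variable {D : ℕ}

/-- [folklore] A nonzero integer alias has `|q|² ≥ π²`. -/
theorem pi_sq_le_momSq_qv {p : Fin D → ℝ} (hp : ∀ i, |p i| ≤ π) {z : Fin D → ℤ} (hz : z ≠ 0) :
    π ^ 2 ≤ momSq (qv p z) := by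
  obtain ⟨i, hi⟩ : ∃ i, z i ≠ 0 := by
    by_contra h; push Not at h; exact hz (funext h)
  have hq := pi_le_abs_qv hp hi
  unfold momSq
  calc π ^ 2 ≤ qv p z i ^ 2 := by rw [← sq_abs (qv p z i)]; exact pow_le_pow_left₀ Real.pi_pos.le hq 2
    _ ≤ ∑ j, qv p z j ^ 2 := Finset.single_le_sum (f := fun j => qv p z j ^ 2) (fun j _ => sq_nonneg _) (Finset.mem_univ i)

/-! ## §7 Assembly: the two-scale (level `N` versus level `N' ≥ N`) rate of the capacitance scalars -/

/-- [folklore] BOX TERM for `ã`: at an alias momentum of the level-`N` box, `|fA N' − fA N| ≤ (π²/32)·Kc D·pwInf/N²`. -/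
theorem abs_fA_sub_fA_le {N N' : ℕ} (hN : 0 < N) (hNN' : N ≤ N') {q : Fin D → ℝ} (hq : ∀ i, |q i| ≤ π * N)
    (hq0 : 0 < momSq q) (κ : Fin D) :
    |fA N' κ q - fA N κ q| ≤ π ^ 2 / 32 * Kc D / (N : ℝ) ^ 2 * pwInf q := by
  have hN' : 0 < N' := lt_of_lt_of_le hN hNN'
  have hNR : (0 : ℝ) < N := by exact_mod_cast hN
  have hNN'R : (N : ℝ) ≤ N' := by exact_mod_cast hNN'
  have hq' : ∀ i, |q i| ≤ π * N' := fun i => (hq i).trans (by nlinarith [Real.pi_pos])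
  obtain ⟨l1, -, l3⟩ := fA_rel hN hq hq0 κ
  obtain ⟨u1, -, u3⟩ := fA_rel hN' hq' hq0 κ
  have hKc0 : 0 ≤ Kc D := le_trans zero_le_one (one_le_Kc D)
  have hf0 : 0 ≤ fAinf κ q := by
    unfold fAinf; exact div_nonneg (mul_nonneg (pwInf_nonneg q) (awInf_nonneg _)) (by positivity)
  -- the level-N' excess is bounded by the level-N excess bound
  have hmono : π ^ 2 / 16 * (momSq q / (N' : ℝ) ^ 2) * Kc D * fAinf κ q
      ≤ π ^ 2 / 16 * (momSq q / (N : ℝ) ^ 2) * Kc D * fAinf κ q := by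
    have : momSq q / (N' : ℝ) ^ 2 ≤ momSq q / (N : ℝ) ^ 2 :=
      div_le_div_of_nonneg_left hq0.le (by positivity) (pow_le_pow_left₀ hNR.le hNN'R 2)
    have h2 : 0 ≤ Kc D * fAinf κ q := mul_nonneg hKc0 hf0
    calc π ^ 2 / 16 * (momSq q / (N' : ℝ) ^ 2) * Kc D * fAinf κ q
        = (π ^ 2 / 16 * (momSq q / (N' : ℝ) ^ 2)) * (Kc D * fAinf κ q) := by ring
      _ ≤ (π ^ 2 / 16 * (momSq q / (N : ℝ) ^ 2)) * (Kc D * fAinf κ q) :=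
          mul_le_mul_of_nonneg_right (mul_le_mul_of_nonneg_left this (by positivity)) h2
      _ = π ^ 2 / 16 * (momSq q / (N : ℝ) ^ 2) * Kc D * fAinf κ q := by ring
  -- the common excess bound in `pwInf` currency
  have hB : π ^ 2 / 16 * (momSq q / (N : ℝ) ^ 2) * Kc D * fAinf κ q ≤ π ^ 2 / 32 * Kc D / (N : ℝ) ^ 2 * pwInf q := by
    have e : π ^ 2 / 16 * (momSq q / (N : ℝ) ^ 2) * Kc D * fAinf κ q
        = π ^ 2 / 32 * Kc D / (N : ℝ) ^ 2 * (pwInf q * awInf (q κ)) := by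
      unfold fAinf; field_simp; ring
    rw [e]
    apply mul_le_mul_of_nonneg_left _ (by positivity)
    calc pwInf q * awInf (q κ) ≤ pwInf q * 1 := mul_le_mul_of_nonneg_left (awInf_le_one _) (pwInf_nonneg q)
      _ = pwInf q := mul_one _
  rw [abs_le]
  constructor <;> linarith

/-- [folklore] TAIL TERM for `ã`: at an alias momentum outside the level-`N` box (`|q|² ≥ π²N²`) the level-`N'` summand is
`≤ Kc D·pwInf/(2π²N²)`. -/
theorem fA_tail_le {N N' : ℕ} (hN : 0 < N) (hN' : 0 < N') {q : Fin D → ℝ} (hq' : ∀ i, |q i| ≤ π * N')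
    (hbig : (π * N) ^ 2 ≤ momSq q) (κ : Fin D) :
    fA N' κ q ≤ Kc D / (2 * π ^ 2 * (N : ℝ) ^ 2) * pwInf q := by
  have hπ := Real.pi_pos
  have hNR : (0 : ℝ) < N := by exact_mod_cast hN
  have hq0 : 0 < momSq q := lt_of_lt_of_le (by positivity) hbig
  obtain ⟨-, u2, -⟩ := fA_rel hN' hq' hq0 κ
  have hKc0 : 0 ≤ Kc D := le_trans zero_le_one (one_le_Kc D)
  calc fA N' κ q ≤ Kc D * fAinf κ q := u2
    _ = Kc D * (pwInf q * awInf (q κ)) / (2 * momSq q) := by unfold fAinf; ring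
    _ ≤ Kc D * pwInf q / (2 * momSq q) := by
        apply div_le_div_of_nonneg_right _ (by positivity)
        calc Kc D * (pwInf q * awInf (q κ)) ≤ Kc D * (pwInf q * 1) :=
              mul_le_mul_of_nonneg_left (mul_le_mul_of_nonneg_left (awInf_le_one _) (pwInf_nonneg q)) hKc0
          _ = Kc D * pwInf q := by rw [mul_one]
    _ ≤ Kc D * pwInf q / (2 * (π * N) ^ 2) :=
        div_le_div_of_nonneg_left (mul_nonneg hKc0 (pwInf_nonneg q)) (by positivity) (by linarith)
    _ = Kc D / (2 * π ^ 2 * (N : ℝ) ^ 2) * pwInf q := by field_simp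

/-- [folklore] BOX TERM for `σ̃`: `|fS N' − fS N| ≤ (π²/16)·Kc D·(pwInf/|q|²)/N²` at an alias momentum of the level-`N` box. -/
theorem abs_fS_sub_fS_le {N N' : ℕ} (hN : 0 < N) (hNN' : N ≤ N') {q : Fin D → ℝ} (hq : ∀ i, |q i| ≤ π * N)
    (hq0 : 0 < momSq q) :
    |fS N' q - fS N q| ≤ π ^ 2 / 16 * Kc D / (N : ℝ) ^ 2 * (pwInf q / momSq q) := by
  have hN' : 0 < N' := lt_of_lt_of_le hN hNN'
  have hNR : (0 : ℝ) < N := by exact_mod_cast hN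
  have hNN'R : (N : ℝ) ≤ N' := by exact_mod_cast hNN'
  have hq' : ∀ i, |q i| ≤ π * N' := fun i => (hq i).trans (by nlinarith [Real.pi_pos])
  obtain ⟨l1, -, l3⟩ := fS_rel hN hq hq0
  obtain ⟨u1, -, u3⟩ := fS_rel hN' hq' hq0
  have hKc0 : 0 ≤ Kc D := le_trans zero_le_one (one_le_Kc D)
  have hf0 : 0 ≤ fSinf q := by unfold fSinf; exact div_nonneg (pwInf_nonneg q) (by positivity)
  have hmono : π ^ 2 / 16 * (momSq q / (N' : ℝ) ^ 2) * Kc D * fSinf q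
      ≤ π ^ 2 / 16 * (momSq q / (N : ℝ) ^ 2) * Kc D * fSinf q := by
    have : momSq q / (N' : ℝ) ^ 2 ≤ momSq q / (N : ℝ) ^ 2 :=
      div_le_div_of_nonneg_left hq0.le (by positivity) (pow_le_pow_left₀ hNR.le hNN'R 2)
    have h2 : 0 ≤ Kc D * fSinf q := mul_nonneg hKc0 hf0
    calc π ^ 2 / 16 * (momSq q / (N' : ℝ) ^ 2) * Kc D * fSinf q
        = (π ^ 2 / 16 * (momSq q / (N' : ℝ) ^ 2)) * (Kc D * fSinf q) := by ring
      _ ≤ (π ^ 2 / 16 * (momSq q / (N : ℝ) ^ 2)) * (Kc D * fSinf q) :=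
          mul_le_mul_of_nonneg_right (mul_le_mul_of_nonneg_left this (by positivity)) h2
      _ = π ^ 2 / 16 * (momSq q / (N : ℝ) ^ 2) * Kc D * fSinf q := by ring
  have e : π ^ 2 / 16 * (momSq q / (N : ℝ) ^ 2) * Kc D * fSinf q
      = π ^ 2 / 16 * Kc D / (N : ℝ) ^ 2 * (pwInf q / momSq q) := by
    unfold fSinf; field_simp
  rw [abs_le]
  constructor <;> linarith

/-- [folklore] TAIL TERM for `σ̃`: outside the level-`N` box the level-`N'` summand is `≤ Kc D·pwInf/(π⁴N²)`. -/
theorem fS_tail_le {N N' : ℕ} (hN : 0 < N) (hN' : 0 < N') {q : Fin D → ℝ} (hq' : ∀ i, |q i| ≤ π * N')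
    (hbig : (π * N) ^ 2 ≤ momSq q) : fS N' q ≤ Kc D / (π ^ 4 * (N : ℝ) ^ 2) * pwInf q := by
  have hπ := Real.pi_pos
  have hNR : (1 : ℝ) ≤ N := by exact_mod_cast hN
  have hππ : 0 < (π * N) ^ 2 := by positivity
  have hq0 : 0 < momSq q := lt_of_lt_of_le hππ hbig
  obtain ⟨-, u2, -⟩ := fS_rel hN' hq' hq0
  have hKc0 : 0 ≤ Kc D := le_trans zero_le_one (one_le_Kc D)
  have hm2 : π ^ 4 * (N : ℝ) ^ 2 ≤ momSq q ^ 2 := by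
    calc π ^ 4 * (N : ℝ) ^ 2 ≤ (π * N) ^ 2 * (π * N) ^ 2 := by
          rw [show π ^ 4 * (N : ℝ) ^ 2 = (π * N) ^ 2 * π ^ 2 by ring, mul_pow]
          exact mul_le_mul_of_nonneg_left (le_mul_of_one_le_right (sq_nonneg π) (one_le_pow₀ hNR))
            (by positivity)
      _ ≤ momSq q * momSq q := mul_le_mul hbig hbig hππ.le hq0.le
      _ = momSq q ^ 2 := by ring
  calc fS N' q ≤ Kc D * fSinf q := u2
    _ = Kc D * pwInf q / momSq q ^ 2 := by unfold fSinf; ring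
    _ ≤ Kc D * pwInf q / (π ^ 4 * (N : ℝ) ^ 2) :=
        div_le_div_of_nonneg_left (mul_nonneg hKc0 (pwInf_nonneg q)) (by positivity) hm2
    _ = Kc D / (π ^ 4 * (N : ℝ) ^ 2) * pwInf q := by ring

/-- [folklore] `Σ_{z ∈ boxZ N p} pwInf(q)/|q|² ≤ 1/|p|² + 3^D/π²` (the zero alias and the rest). -/
theorem sum_boxZ_pwInf_div_le {N : ℕ} [NeZero N] {p : Fin D → ℝ} (hp : ∀ i, |p i| ≤ π) (hp0 : p ≠ 0) :
    ∑ z ∈ boxZ N p, pwInf (qv p z) / momSq (qv p z) ≤ 1 / momSq p + (3 : ℝ) ^ D / π ^ 2 := by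
  classical
  have hπ := Real.pi_pos
  have hmp : 0 < momSq p := by
    have h := momSq_qv_pos hp hp0 0
    rwa [show qv p (0 : Fin D → ℤ) = p from funext fun i => by simp [qv]] at h
  have hterm : ∀ z ∈ boxZ N p, pwInf (qv p z) / momSq (qv p z)
      ≤ (if z = 0 then 1 / momSq p else 0) + pwInf (qv p z) / π ^ 2 := by
    intro z _
    split_ifs with hz
    · subst hz
      have hq : qv p 0 = p := by funext i; simp [qv]
      rw [hq]
      have h1 : pwInf p / momSq p ≤ 1 / momSq p := div_le_div_of_nonneg_right (pwInf_le_one p) hmp.le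
      have h2 : 0 ≤ pwInf p / π ^ 2 := div_nonneg (pwInf_nonneg p) (by positivity)
      linarith
    · rw [zero_add]
      exact div_le_div_of_nonneg_left (pwInf_nonneg _) (by positivity) (pi_sq_le_momSq_qv hp hz)
  calc ∑ z ∈ boxZ N p, pwInf (qv p z) / momSq (qv p z)
      ≤ ∑ z ∈ boxZ N p, ((if z = 0 then 1 / momSq p else 0) + pwInf (qv p z) / π ^ 2) := Finset.sum_le_sum hterm
    _ = (∑ z ∈ boxZ N p, if z = 0 then 1 / momSq p else 0) + (∑ z ∈ boxZ N p, pwInf (qv p z)) / π ^ 2 := by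
        rw [Finset.sum_add_distrib, Finset.sum_div]
    _ ≤ 1 / momSq p + (3 : ℝ) ^ D / π ^ 2 := by
        apply add_le_add
        · rw [Finset.sum_ite_eq']
          split_ifs
          · exact le_rfl
          · positivity
        · exact div_le_div_of_nonneg_right (sum_boxZ_pwInf_le hp) (by positivity)

/-- The rate constant of `ã`: `rateA D = Kc D·3^D·(π²/32 + 1/(2π²))`. -/
def rateA (D : ℕ) : ℝ := Kc D * (3 : ℝ) ^ D * (π ^ 2 / 32 + 1 / (2 * π ^ 2))

/-- The rate constant of `σ̃`: `rateS D = Kc D·(π²/16 + 3^D·(1/16 + 1/π⁴))`. -/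
def rateS (D : ℕ) : ℝ := Kc D * (π ^ 2 / 16 + (3 : ℝ) ^ D * (1 / 16 + 1 / π ^ 4))

/-- **TWO-SCALE RATE OF `ã_κ` (Part B for the capacitance scalar `a_κ`; leaf P1-Y11s (R4)).**  For every dimension `D`,
all levels `1 ≤ N ≤ N'`, every Brillouin momentum `p ∈ [−π, π]^D ∖ {0}` and every `κ`:
`|ã_κ^{(N')}(p) − ã_κ^{(N)}(p)| ≤ rateA D / N²` — uniformly in `p` (the `m = 0` pole `1/(2|p|²)` is cancelled by the
relative rate `|q|²/N²`).  With `N = Lc^{j+1}`, `N' = Lc^{j+2}` this is the geometric rate `θ^j`, `θ = Lc⁻²`, of SKELETON-P1 B3/B4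
for the `a_κ`-entries of leaf-02's closed-form capacitance matrix.  [folklore; our proof] -/
theorem aT_rate {N N' : ℕ} [NeZero N] [NeZero N'] (hNN' : N ≤ N') {p : Fin D → ℝ} (hp : ∀ i, |p i| ≤ π)
    (hp0 : p ≠ 0) (κ : Fin D) : |aT N' p κ - aT N p κ| ≤ rateA D / (N : ℝ) ^ 2 := by
  classical
  have hN : 0 < N := Nat.pos_of_ne_zero (NeZero.ne N)
  have hN' : 0 < N' := Nat.pos_of_ne_zero (NeZero.ne N')
  have hπ := Real.pi_pos
  have hKc0 : 0 ≤ Kc D := le_trans zero_le_one (one_le_Kc D)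
  have hsub := boxZ_subset hp hNN' (N := N) (N' := N')
  rw [aT_eq_sum_boxZ, aT_eq_sum_boxZ, ← Finset.sum_sdiff hsub, add_sub_assoc, ← Finset.sum_sub_distrib]
  -- tail
  have htail : ∑ z ∈ boxZ N' p \ boxZ N p, fA N' κ (qv p z) ≤ Kc D / (2 * π ^ 2 * (N : ℝ) ^ 2) * (3 : ℝ) ^ D := by
    calc ∑ z ∈ boxZ N' p \ boxZ N p, fA N' κ (qv p z)
        ≤ ∑ z ∈ boxZ N' p \ boxZ N p, Kc D / (2 * π ^ 2 * (N : ℝ) ^ 2) * pwInf (qv p z) :=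
          Finset.sum_le_sum fun z hz => by
            obtain ⟨hz', hzN⟩ := Finset.mem_sdiff.1 hz
            exact fA_tail_le hN hN' (abs_qv_le_of_mem_boxZ hp hz') (sq_le_momSq_of_not_mem_boxZ hp hzN) κ
      _ ≤ ∑ z ∈ boxZ N' p, Kc D / (2 * π ^ 2 * (N : ℝ) ^ 2) * pwInf (qv p z) :=
          Finset.sum_le_sum_of_subset_of_nonneg Finset.sdiff_subset fun z _ _ =>
            mul_nonneg (by positivity) (pwInf_nonneg _)
      _ = Kc D / (2 * π ^ 2 * (N : ℝ) ^ 2) * ∑ z ∈ boxZ N' p, pwInf (qv p z) := by rw [Finset.mul_sum]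
      _ ≤ Kc D / (2 * π ^ 2 * (N : ℝ) ^ 2) * (3 : ℝ) ^ D :=
          mul_le_mul_of_nonneg_left (sum_boxZ_pwInf_le hp) (by positivity)
  have htail0 : 0 ≤ ∑ z ∈ boxZ N' p \ boxZ N p, fA N' κ (qv p z) :=
    Finset.sum_nonneg fun z hz => by
      obtain ⟨hz', -⟩ := Finset.mem_sdiff.1 hz
      obtain ⟨l1, -, -⟩ := fA_rel hN' (abs_qv_le_of_mem_boxZ hp hz') (momSq_qv_pos hp hp0 z) κ
      have : 0 ≤ fAinf κ (qv p z) := by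
        unfold fAinf
        exact div_nonneg (mul_nonneg (pwInf_nonneg _) (awInf_nonneg _))
          (mul_nonneg zero_le_two (momSq_qv_pos hp hp0 z).le)
      linarith
  -- box
  have hbox : |∑ z ∈ boxZ N p, (fA N' κ (qv p z) - fA N κ (qv p z))| ≤ π ^ 2 / 32 * Kc D / (N : ℝ) ^ 2 * (3 : ℝ) ^ D := by
    calc |∑ z ∈ boxZ N p, (fA N' κ (qv p z) - fA N κ (qv p z))|
        ≤ ∑ z ∈ boxZ N p, |fA N' κ (qv p z) - fA N κ (qv p z)| := Finset.abs_sum_le_sum_abs _ _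
      _ ≤ ∑ z ∈ boxZ N p, π ^ 2 / 32 * Kc D / (N : ℝ) ^ 2 * pwInf (qv p z) :=
          Finset.sum_le_sum fun z hz =>
            abs_fA_sub_fA_le hN hNN' (abs_qv_le_of_mem_boxZ hp hz) (momSq_qv_pos hp hp0 z) κ
      _ = π ^ 2 / 32 * Kc D / (N : ℝ) ^ 2 * ∑ z ∈ boxZ N p, pwInf (qv p z) := by rw [Finset.mul_sum]
      _ ≤ π ^ 2 / 32 * Kc D / (N : ℝ) ^ 2 * (3 : ℝ) ^ D :=
          mul_le_mul_of_nonneg_left (sum_boxZ_pwInf_le hp) (by positivity)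
  have e : rateA D / (N : ℝ) ^ 2
      = Kc D / (2 * π ^ 2 * (N : ℝ) ^ 2) * (3 : ℝ) ^ D + π ^ 2 / 32 * Kc D / (N : ℝ) ^ 2 * (3 : ℝ) ^ D := by
    unfold rateA; field_simp; ring
  rw [e]
  calc |∑ z ∈ boxZ N' p \ boxZ N p, fA N' κ (qv p z) + ∑ z ∈ boxZ N p, (fA N' κ (qv p z) - fA N κ (qv p z))|
      ≤ |∑ z ∈ boxZ N' p \ boxZ N p, fA N' κ (qv p z)| + |∑ z ∈ boxZ N p, (fA N' κ (qv p z) - fA N κ (qv p z))| :=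
        abs_add_le _ _
    _ ≤ Kc D / (2 * π ^ 2 * (N : ℝ) ^ 2) * (3 : ℝ) ^ D + π ^ 2 / 32 * Kc D / (N : ℝ) ^ 2 * (3 : ℝ) ^ D := by
        rw [abs_of_nonneg htail0]; exact add_le_add htail hbox

/-- **TWO-SCALE RATE OF `σ̃` (Part B for the capacitance scalar `σ`; leaf P1-Y11s (R4)).**  For every `D`, all levels
`1 ≤ N ≤ N'`, every `p ∈ [−π, π]^D ∖ {0}`: `|σ̃^{(N')}(p) − σ̃^{(N)}(p)| ≤ rateS D·(1 + 1/|p|²)/N²` (the `m = 0` summand is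
`|p|⁻⁴`, its relative rate `|p|²/N²` leaves `|p|⁻²/N²`).  [folklore; our proof] -/
theorem sT_rate {N N' : ℕ} [NeZero N] [NeZero N'] (hNN' : N ≤ N') {p : Fin D → ℝ} (hp : ∀ i, |p i| ≤ π)
    (hp0 : p ≠ 0) : |sT N' p - sT N p| ≤ rateS D * (1 + 1 / momSq p) / (N : ℝ) ^ 2 := by
  classical
  have hN : 0 < N := Nat.pos_of_ne_zero (NeZero.ne N)
  have hN' : 0 < N' := Nat.pos_of_ne_zero (NeZero.ne N')
  have hπ := Real.pi_pos
  have hKc0 : 0 ≤ Kc D := le_trans zero_le_one (one_le_Kc D)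
  have hmp : 0 < momSq p := by
    have h := momSq_qv_pos hp hp0 0
    rwa [show qv p (0 : Fin D → ℤ) = p from funext fun i => by simp [qv]] at h
  have hsub := boxZ_subset hp hNN' (N := N) (N' := N')
  rw [sT_eq_sum_boxZ, sT_eq_sum_boxZ, ← Finset.sum_sdiff hsub, add_sub_assoc, ← Finset.sum_sub_distrib]
  have htail : ∑ z ∈ boxZ N' p \ boxZ N p, fS N' (qv p z) ≤ Kc D / (π ^ 4 * (N : ℝ) ^ 2) * (3 : ℝ) ^ D := by
    calc ∑ z ∈ boxZ N' p \ boxZ N p, fS N' (qv p z)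
        ≤ ∑ z ∈ boxZ N' p \ boxZ N p, Kc D / (π ^ 4 * (N : ℝ) ^ 2) * pwInf (qv p z) :=
          Finset.sum_le_sum fun z hz => by
            obtain ⟨hz', hzN⟩ := Finset.mem_sdiff.1 hz
            exact fS_tail_le hN hN' (abs_qv_le_of_mem_boxZ hp hz') (sq_le_momSq_of_not_mem_boxZ hp hzN)
      _ ≤ ∑ z ∈ boxZ N' p, Kc D / (π ^ 4 * (N : ℝ) ^ 2) * pwInf (qv p z) :=
          Finset.sum_le_sum_of_subset_of_nonneg Finset.sdiff_subset fun z _ _ =>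
            mul_nonneg (by positivity) (pwInf_nonneg _)
      _ = Kc D / (π ^ 4 * (N : ℝ) ^ 2) * ∑ z ∈ boxZ N' p, pwInf (qv p z) := by rw [Finset.mul_sum]
      _ ≤ Kc D / (π ^ 4 * (N : ℝ) ^ 2) * (3 : ℝ) ^ D :=
          mul_le_mul_of_nonneg_left (sum_boxZ_pwInf_le hp) (by positivity)
  have htail0 : 0 ≤ ∑ z ∈ boxZ N' p \ boxZ N p, fS N' (qv p z) :=
    Finset.sum_nonneg fun z hz => by
      obtain ⟨hz', -⟩ := Finset.mem_sdiff.1 hz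
      obtain ⟨l1, -, -⟩ := fS_rel hN' (abs_qv_le_of_mem_boxZ hp hz') (momSq_qv_pos hp hp0 z)
      have : 0 ≤ fSinf (qv p z) := by unfold fSinf; exact div_nonneg (pwInf_nonneg _) (by positivity)
      linarith
  have hbox : |∑ z ∈ boxZ N p, (fS N' (qv p z) - fS N (qv p z))|
      ≤ π ^ 2 / 16 * Kc D / (N : ℝ) ^ 2 * (1 / momSq p + (3 : ℝ) ^ D / π ^ 2) := by
    calc |∑ z ∈ boxZ N p, (fS N' (qv p z) - fS N (qv p z))|
        ≤ ∑ z ∈ boxZ N p, |fS N' (qv p z) - fS N (qv p z)| := Finset.abs_sum_le_sum_abs _ _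
      _ ≤ ∑ z ∈ boxZ N p, π ^ 2 / 16 * Kc D / (N : ℝ) ^ 2 * (pwInf (qv p z) / momSq (qv p z)) :=
          Finset.sum_le_sum fun z hz =>
            abs_fS_sub_fS_le hN hNN' (abs_qv_le_of_mem_boxZ hp hz) (momSq_qv_pos hp hp0 z)
      _ = π ^ 2 / 16 * Kc D / (N : ℝ) ^ 2 * ∑ z ∈ boxZ N p, pwInf (qv p z) / momSq (qv p z) := by
          rw [Finset.mul_sum]
      _ ≤ π ^ 2 / 16 * Kc D / (N : ℝ) ^ 2 * (1 / momSq p + (3 : ℝ) ^ D / π ^ 2) :=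
          mul_le_mul_of_nonneg_left (sum_boxZ_pwInf_div_le hp hp0) (by positivity)
  -- collect: tail + box ≤ rateS (1 + 1/|p|²)/N²
  have hfin : Kc D / (π ^ 4 * (N : ℝ) ^ 2) * (3 : ℝ) ^ D
      + π ^ 2 / 16 * Kc D / (N : ℝ) ^ 2 * (1 / momSq p + (3 : ℝ) ^ D / π ^ 2)
      ≤ rateS D * (1 + 1 / momSq p) / (N : ℝ) ^ 2 := by
    have hNR : (0 : ℝ) < (N : ℝ) ^ 2 := by positivity
    have hm0 : 0 ≤ 1 / momSq p := by positivity
    unfold rateS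
    have e1 : Kc D / (π ^ 4 * (N : ℝ) ^ 2) * (3 : ℝ) ^ D
        + π ^ 2 / 16 * Kc D / (N : ℝ) ^ 2 * (1 / momSq p + (3 : ℝ) ^ D / π ^ 2)
        = (Kc D * (π ^ 2 / 16 * (1 / momSq p) + (3 : ℝ) ^ D * (1 / 16 + 1 / π ^ 4))) / (N : ℝ) ^ 2 := by
      field_simp; ring
    rw [e1, div_le_div_iff_of_pos_right hNR]
    have h3 : 0 ≤ (3 : ℝ) ^ D * (1 / 16 + 1 / π ^ 4) := by positivity
    have h4 : 0 ≤ π ^ 2 / 16 := by positivity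
    nlinarith [mul_nonneg hKc0 h3, mul_nonneg hKc0 h4, mul_nonneg (mul_nonneg hKc0 h3) hm0,
      mul_nonneg (mul_nonneg hKc0 h4) hm0]
  calc |∑ z ∈ boxZ N' p \ boxZ N p, fS N' (qv p z) + ∑ z ∈ boxZ N p, (fS N' (qv p z) - fS N (qv p z))|
      ≤ |∑ z ∈ boxZ N' p \ boxZ N p, fS N' (qv p z)| + |∑ z ∈ boxZ N p, (fS N' (qv p z) - fS N (qv p z))| :=
        abs_add_le _ _
    _ ≤ Kc D / (π ^ 4 * (N : ℝ) ^ 2) * (3 : ℝ) ^ D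
        + π ^ 2 / 16 * Kc D / (N : ℝ) ^ 2 * (1 / momSq p + (3 : ℝ) ^ D / π ^ 2) := by
        rw [abs_of_nonneg htail0]; exact add_le_add htail hbox
    _ ≤ rateS D * (1 + 1 / momSq p) / (N : ℝ) ^ 2 := hfin

end Summit.QuantumFields.BalabanUV.Beta.GAN24.CapacitanceScalarRateSum

end
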